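import Summits.BirchSwinnertonDyer.Rank1Residual.X11b.KolyvaginTauEigenConcrete
import Summits.BirchSwinnertonDyer.BirchSwinnertonDyer.Theorems.KolyvaginRoadThreePointCertificate
import Summits.BirchSwinnertonDyer.BirchSwinnertonDyer.Theorems.KolyvaginRoadThreeLevelData
import Summits.BirchSwinnertonDyer.Rank1Residual.X11b.KolyvaginHpointsAssembly
import HarnessLib

/-!
# T1 JET (cell `bsd-jet`), road K: the SIGN of the concrete Kolyvagin class under complex conjugation —
# Gross 1991 Prop. 5.4 `τ c_M(n) = ε_n c_M(n)`, `ε_n = ε · (−1)^{#primes of n}` — at ZHANG–Kolyvagin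
# levels (the currency of the road-K conductors), modulo Gross Prop. 5.3; the input `hκsign` of
# `JET.tamagawaExponent_le_mInfty_of_rowData` (p492296)

HONEST FRAMING (programme file §HONESTY, verbatim): «no tranche here proves BSD; ARM L moves the
LITERAL column of an r ≤ 1 census into the kernel-proved-modulo-named-print column.» THEOREMS ONLY
(seat `bsd-jet-pv-2`, session g3; `--supports stmt-BirchSwinnertonDyer-14418`, helper); 0 classes
move. WHAT THIS IS. x11b3's `KolyvaginTauEigen.pointsMap_derivedPoint_concrete_of_prop53` (Gross Prop.
5.4 (1) for the CONCRETE derived points, modulo `h53` = Gross Prop. 5.3 at the conductor, cite-only)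
takes the prime factors of the top level in GROSS currency `IsKolyvaginPrime N W K p q ∧
FrobEqFrobInfty W K (p^M) q`; the road-K conductors (outputs of McCallum Prop. 5.2 / K5 =
`JET.JetchevCoreVertexExistence`) come in ZHANG currency `Zhang2014.IsKolyvaginPrime N W K p q ∧
M ≤ Zhang2014.kolyvaginIndex W p q` (the printed congruences `p^M ∣ a_q`, `p^M ∣ q + 1`). Following the
pattern of `KolyCert.toGeomPoints_derivedPoint_mem_invPoints_of_dvd_zhang` (route KolyvaginRoadThree),
this file RE-RUNS x11b3's proof verbatim with the two currency-dependent inputs — McCallum's (4)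
`γP_m ≡ P_m` and `Tr_ℓ y_m ∈ p^M E(K_m)` — taken from their Zhang re-typings
(`KolyCert.smul_kolyvaginPoint_sub_mem_of_dvd_zhang`, `KolyCert.grAct_traceElt_mem_of_dvd_zhang`):
* `pointsMap_derivedPoint_concrete_of_prop53_zhang` — Gross Prop. 5.4 (1): `τ P_m = ε_m P_m + p^M B`;
* `conjAct_kolyvaginClass_eq_sign_smul_zhang` — Gross Prop. 5.4 (2) for the concrete CLASS:
  `τ_* c_M(m) = ε_m • c_M(m)` in `H¹(K, E[p^M])` (`conjAct`), by the cocycle functoriality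
  `conjAct_kolyvaginClass_eq_smul` (Literature) on the admissible/invariant branch and trivially on the
  junk branch;
* `exists_sign_conjAct_kolyvaginClass_of_prop53` — the `hκsign` input of the row theorem in the H63
  binder's currency (one conductor `c ∈ Λ_k`, one datum), modulo Prop. 5.3 for all data and the two
  Gross §3 CM facts (data at the divisors, as in `JET.exists_datum_addOrderOf_kolyvaginClass_of_m_eq`).
References: [cite: GrossLMS1991, §5 (5.2), Prop. 5.3, Prop. 5.4 (1)–(2) and proofs; §3 (3.3), (3.5),
Prop. 3.6; §4 (4.1), Lemma 4.3] [cite: McCallumLMS1991, §4 (4)–(6)]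
[cite: WZhang2014, Notations (xii)] [cite: Jetchev2008, §4.1.3 (p. 818: ε(c)), proof of Thm. 5.2].
-/

set_option autoImplicit false

noncomputable section

open scoped Classical
open WeierstrassCurve Field NumberField IsDedekindDomain Finset
open Literature.NumberTheory.EllipticCurves Literature.NumberTheory.GaloisRepresentations
open Literature.NumberTheory.EllipticCurves.KolyvaginCocycle Literature.NumberTheory.EllipticCurves.KolyvaginEuler
open Literature.NumberTheory.EllipticCurves.RingClassField Literature.NumberTheory.EllipticCurves.ModularForms
open Summit.BirchSwinnertonDyer.Rank1Residual.X11b Summit.BirchSwinnertonDyer.Rank1Residual.X11b.Three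
open Summit.BirchSwinnertonDyer.Rank1Residual.X11b.KolyvaginTauEigen

namespace Summit.BirchSwinnertonDyer.Rank1Residual.JET

-- `K : Type`: the tree's ring-class class field theory is universe `0`.
variable {K : Type} [Field K] [NumberField K] {N : ℕ} {W : WeierstrassCurve ℚ}

/-- **Gross 1991 Prop. 5.4 (1) for the CONCRETE derived points at ZHANG–Kolyvagin levels**
(`τ P_m = ε_m P_m + p^M B`, `ε_m = ε·(−1)^{#primes of m}`, `B ∈ E(K_m)`): x11b3's
`KolyvaginTauEigen.pointsMap_derivedPoint_concrete_of_prop53` VERBATIM, with the prime factors of the top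
level `n` given as `Zhang2014.IsKolyvaginPrime N W K p q ∧ M ≤ Zhang2014.kolyvaginIndex W p q` instead of
`IsKolyvaginPrime ∧ FrobEqFrobInfty (p^M)`; the two inputs that used the Frobenius form (McCallum's (4)
`γ P_m − P_m ∈ p^M E(K_m)` and `Tr_ℓ y_m ∈ p^M E(K_m)`, i.e. (β2) + the congruences (3.3)) are taken from
`KolyCert.smul_kolyvaginPoint_sub_mem_of_dvd_zhang` / `KolyCert.grAct_traceElt_mem_of_dvd_zhang`, and
`p^M ∣ ℓ + 1` from `Zhang2014.le_kolyvaginIndex_iff`. CONDITIONAL on `h53` = Gross Prop. 5.3 at the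
conductor in printed form (cite-only, not a Literature fact; x11b3 `KolyvaginA53.h53_of_recM` reduces it
to Shimura reciprocity at the conductor) and the admissibility `hA` (Gross Lemma 4.3).
[cite: GrossLMS1991, §5 Prop. 5.4 (1) and proof, Prop. 5.3, §3 (τστ⁻¹ = σ⁻¹), (3.3), §4 (4.1), Lemma 4.3]
[cite: McCallumLMS1991, §4 (4)–(5)] [cite: WZhang2014, Notations (xii)] -/
theorem pointsMap_derivedPoint_concrete_of_prop53_zhang [NeZero N] [W.IsElliptic] [W.IsGloballyMinimal]
    (hK : IsImaginaryQuadratic K) (ι : K →+* ℂ)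
    {p M : ℕ} (hp : p.Prime) (hM : 1 ≤ M)
    (Dt : ModularParametrizationData W N) {β : ℤ}
    (hND : IsCoprime (N : ℤ) (NumberField.discr K)) (hD : NumberField.discr K < -4)
    {n : ℕ} (hn : Squarefree n)
    (hkol : ∀ q ∈ n.primeFactors,
      Zhang2014.IsKolyvaginPrime N W K p q ∧ M ≤ Zhang2014.kolyvaginIndex W p q)
    (d : (m : ℕ) → m ∣ n → KolyvaginHeegnerData Dt β ι m)
    {c : K ≃ₐ[ℚ] K} (hc : c ≠ 1) {τ : AlgebraicClosure K ≃+* AlgebraicClosure K}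
    (hτ : IsLiftOfAut c τ) (ε : ℤ)
    (h53 : ∀ (m : ℕ) (hm : m ∣ n) (τm : ringClassField K ι m ≃ₐ[ℚ] ringClassField K ι m),
      (∀ x : ringClassField K ι m, ((τm x : ringClassField K ι m) : ℂ) = starRingEnd ℂ x) →
      ∃ σ' ∈ ringClassGal ι m, IsOfFinAddOrder
        (pointGalHom W (ringClassField K ι m) τm (d m hm).y -
          ε • pointGalHom W (ringClassField K ι m) σ' (d m hm).y))
    (hA : ∀ (m : ℕ) (hm : m ∣ n),
      IsAdmissible (absoluteGaloisGroup K) (d m hm).pointsSubgroup ((p ^ M : ℕ) : ℤ)) :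
    ∀ (m : ℕ) (hm : m ∣ n), ∃ B ∈ (d m hm).pointsSubgroup,
      hτ.pointsMap W ((d m hm).toGeomPoints (d m hm).derivedPoint) =
        (ε * (-1) ^ m.primeFactors.card) • (d m hm).toGeomPoints (d m hm).derivedPoint +
          ((p ^ M : ℕ) : ℤ) • B := by
  intro m hm
  haveI : Fact p.Prime := ⟨hp⟩
  have hn0 : n ≠ 0 := Squarefree.ne_zero hn
  have hm0 : m ≠ 0 := ne_zero_of_dvd_ne_zero hn0 hm
  have hinert : ∀ q ∈ n.primeFactors, (Ideal.span {(q : 𝓞 K)}).IsPrime :=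
    fun q hq ↦ (hkol q hq).1.2.2.2.2.1
  -- THE SEAM: level data at every level (`exists_levelData`)
  choose σ H f y π j e hord hj hπρ hfsec hHρ hdict hjunk using
    fun k ↦ KolyvaginH44.exists_levelData (W := W) (Dt := Dt) (β := β) hK ι hn hinert d k
  -- `𝒢_m = ringClassGal ι m`, a finite commutative group acting on `E(K[m])` through `pointGalHom`
  letI hcg : ∀ k, CommGroup (ringClassGal ι k) := fun k ↦
    { (inferInstance : Group (ringClassGal ι k)) with
      mul_comm := fun a b ↦ (KolyvaginH44.isMulCommutative_ringClassGal' hK ι k).is_comm.comm a b }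
  haveI hfin : ∀ k, Finite (ringClassGal ι k) := KolyvaginH44.finite_ringClassGal hK ι
  letI act : ∀ k, DistribMulAction (ringClassGal ι k)
      ((W.baseChange (ringClassField K ι k)).toAffine.Point) := fun k ↦
    DistribMulAction.compHom _ ((pointGalHom W (ringClassField K ι k)).comp (ringClassGal ι k).subtype)
  letI hft : ∀ k, Fintype (ringClassGal ι k ⧸ H k) := fun k ↦ Fintype.ofFinite _
  have hsmul : ∀ (k) (g : ringClassGal ι k) (Q : (W.baseChange (ringClassField K ι k)).toAffine.Point),
      g • Q = pointGalHom W (ringClassField K ι k)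
        (g : ringClassField K ι k ≃ₐ[ℚ] ringClassField K ι k) Q := fun _ _ _ ↦ rfl
  have hmul : ∀ (a b : ringClassField K ι m ≃ₐ[ℚ] ringClassField K ι m)
      (Q : (W.baseChange (ringClassField K ι m)).toAffine.Point),
      pointGalHom W (ringClassField K ι m) (a * b) Q =
        pointGalHom W (ringClassField K ι m) a (pointGalHom W (ringClassField K ι m) b Q) :=
    fun a b Q ↦ by rw [map_mul]; rfl
  -- the inclusion `ρ_m : 𝒢_m ≤ Aut_ℚ(K[m])` (the identity `iA_m` is `AddEquiv.refl`)
  set ρ : ∀ k, ringClassGal ι k →* (ringClassField K ι k ≃ₐ[ℚ] ringClassField K ι k) :=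
    fun k ↦ (ringClassGal ι k).subtype with hρdef
  have hρ : ∀ k, Function.Injective (ρ k) := fun k ↦ (ringClassGal ι k).subtype_injective
  have hyA : ∀ (k : ℕ) (hk : k ∣ n), AddEquiv.refl _ (y k) = (d k hk).y :=
    fun k hk ↦ (hdict k hk).2.1
  have hσA : ∀ (k : ℕ) (hk : k ∣ n), ∀ q ∈ k.primeFactors, ρ k (σ k q) = (d k hk).σ q :=
    fun k hk ↦ (hdict k hk).2.2.1
  -- the abstract Kolyvagin point IS `P(m)` (x11b3-p8's G1), inside `E(K[m])`
  have hPE : kolyvaginPoint (σ m) m.primeFactors (f m) (y m) = (d m hm).derivedPoint := by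
    obtain ⟨-, hym, hσm, hfS⟩ := hdict m hm
    have hbij := KolyvaginH37Bridge.bijOn_of_section_of_transversal (ρ m) (hρ m)
      (H := H m) (Γ := ringClassGal ι m) (G₁ := ringClassGalOver ι m 1) (hHρ m)
      (S := ((d m hm).S : Set _)) (fun s hs ↦ (d m hm).S_subset s hs)
      (fun s hs ↦ ⟨⟨s, (d m hm).S_subset s hs⟩, rfl⟩) (d m hm).S_transversal (f m) (hfsec m) hfS
    have h := KolyvaginH37Bridge.map_kolyvaginPoint_eq_derivedPoint
      (pointGalHom W (ringClassField K ι m)) (ρ m) (AddMonoidHom.id _) (fun g a ↦ hsmul m g a)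
      (hn.squarefree_of_dvd hm) hσm (f m) hbij (y m)
    rw [AddMonoidHom.id_apply, AddMonoidHom.id_apply, hym] at h
    rw [hym]
    exact h
  -- McCallum's (4): `γ P(m) − P(m) ∈ p^M E(K[m])` for `γ ∈ 𝒢_m` (x11b3-p4)
  have h4 : ∀ γ : ringClassGal ι m,
      γ • kolyvaginPoint (σ m) m.primeFactors (f m) (y m) -
          kolyvaginPoint (σ m) m.primeFactors (f m) (y m) ∈
        zsmulRange ((W.baseChange (ringClassField K ι m)).toAffine.Point) ((p ^ M : ℕ) : ℤ) :=
    KolyCert.smul_kolyvaginPoint_sub_mem_of_dvd_zhang hK ι Dt hp hND hD hn hkol d σ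
      (fun k ↦ k.primeFactors) H f y ρ hρ (fun _ ↦ AddEquiv.refl _)
      (fun k _ g a ↦ hsmul k g a) hyA hσA (fun _ _ ↦ rfl) (fun k _ ↦ hfsec k) (fun k _ ↦ hHρ k)
      m hm
  -- the Euler hypotheses of Prop. 5.4 (1) at level `m`
  have hgen : H m ≤ Subgroup.closure (σ m '' (m.primeFactors : Set ℕ)) :=
    KolyvaginH44.le_closure_of_dvd hK ι Dt hn d σ (fun k ↦ k.primeFactors) H ρ hρ hσA
      (fun _ _ ↦ rfl) (fun k _ ↦ hHρ k) m hm
  have hdvd : ∀ ℓ ∈ m.primeFactors, ((p ^ M : ℕ) : ℤ) ∣ ((ℓ + 1 : ℕ) : ℤ) := by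
    intro ℓ hℓ
    obtain ⟨-, hℓM⟩ := hkol ℓ (Nat.primeFactors_mono hm hn0 hℓ)
    exact Int.natCast_dvd_natCast.mpr (Zhang2014.le_kolyvaginIndex_iff.mp hℓM).1
  have htr : ∀ ℓ ∈ m.primeFactors,
      grAct ((W.baseChange (ringClassField K ι m)).toAffine.Point) (traceElt (σ m ℓ) ℓ) (y m) ∈
        zsmulRange ((W.baseChange (ringClassField K ι m)).toAffine.Point) ((p ^ M : ℕ) : ℤ) :=
    KolyCert.grAct_traceElt_mem_of_dvd_zhang hK ι Dt hp hND hD hn hkol d σ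
      (fun k ↦ k.primeFactors) y ρ (fun _ ↦ AddEquiv.refl _) (fun k _ g a ↦ hsmul k g a) hyA hσA
      (fun _ _ ↦ rfl) m hm
  -- the conjugation automorphism `τ_m` of `K[m]` and the restriction `τ|K[m] = τ_m · h` (x11b3-p8)
  obtain ⟨τm, hτm⟩ := RingClassConj.exists_conj_algEquiv hK ι hm0
  have hτm𝒢 : τm ∉ ringClassGal ι m := RingClassConj.conj_not_mem_ringClassGal hτm hK
  obtain ⟨h, hh𝒢, hres⟩ :=
    RingClassConj.exists_mem_ringClassGal_apply_emb_eq hK hm0 (d m hm) hc hτ hτm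
  -- no `p^M`-torsion in `E(K[m])` (Lemma 4.3, from `hA` along the injective `toGeomPoints`)
  have hX : ∀ a : (W.baseChange (ringClassField K ι m)).toAffine.Point,
      ((p ^ M : ℕ) : ℤ) • a = 0 → a = 0 := by
    intro a ha
    have h0 : (d m hm).toGeomPoints a = 0 := by
      refine (hA m hm).eq_zero_of_zsmul ⟨a, rfl⟩ ?_
      rw [← map_zsmul (d m hm).toGeomPoints, ha, map_zero]
    have h0' : WeierstrassCurve.Affine.Point.map (W' := W) (d m hm).emb.toRatAlgHom a =
        WeierstrassCurve.Affine.Point.map (W' := W) (d m hm).emb.toRatAlgHom 0 := by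
      rw [map_zero]
      exact h0
    exact WeierstrassCurve.Affine.Point.map_injective (W' := W) (d m hm).emb.toRatAlgHom h0'
  -- `T := τ_m` on `E(K[m])` with `hT : T (γ • a) = γ⁻¹ • T a` ⟸ the dihedral law `τ_m γ τ_m⁻¹ = γ⁻¹`
  -- (Gross §3 / §5; x11b3-p4's `KolyvaginConj.exists_addMonoidHom_map_smul_eq_inv_smul`, BY NAME)
  obtain ⟨T, hTapp', hT⟩ := KolyvaginConj.exists_addMonoidHom_map_smul_eq_inv_smul hK hm0 W (ρ m)
    (fun g ↦ g.2) (AddEquiv.refl _) (fun g a ↦ hsmul m g a) hτm𝒢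
  have hTapp : ∀ P, T P = pointGalHom W (ringClassField K ι m) τm P := fun P ↦ hTapp' P
  -- Prop. 5.3 (A′-53) ⟹ `hτy` in `p^M E(K[m])` currency
  obtain ⟨σ', hσ'𝒢, hford⟩ := h53 m hm τm hτm
  have hτy : T (y m) - ε • (⟨σ', hσ'𝒢⟩ : ringClassGal ι m) • y m ∈
      zsmulRange ((W.baseChange (ringClassField K ι m)).toAffine.Point) ((p ^ M : ℕ) : ℤ) := by
    have hy : y m = (d m hm).y := (hdict m hm).2.1
    rw [hsmul, hTapp, hy]
    exact mem_zsmulRange_of_isOfFinAddOrder hp hM hX hford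
  -- Prop. 5.4 (1), abstract: `τ_m P(m) − ε_m P(m) ∈ p^M E(K[m])`
  have h54 : T (kolyvaginPoint (σ m) m.primeFactors (f m) (y m)) -
        (ε * (-1) ^ m.primeFactors.card) • kolyvaginPoint (σ m) m.primeFactors (f m) (y m) ∈
      zsmulRange ((W.baseChange (ringClassField K ι m)).toAffine.Point) ((p ^ M : ℕ) : ℤ) :=
    conj_kolyvaginPoint_sub_mem (hfsec m) hgen (fun ℓ hℓ ↦ hord m ℓ hℓ) hdvd htr T hT hτy
  -- assemble: `τ · P(m) = (τ_m h) P(m) = τ_m (P(m) + p^M a₁) = ε_m P(m) + p^M (a₂ + τ_m a₁)`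
  obtain ⟨a₁, ha₁⟩ := h4 ⟨h, hh𝒢⟩
  obtain ⟨a₂, ha₂⟩ := h54
  change ((p ^ M : ℕ) : ℤ) • a₁ =
    pointGalHom W (ringClassField K ι m) h (kolyvaginPoint (σ m) m.primeFactors (f m) (y m)) -
      kolyvaginPoint (σ m) m.primeFactors (f m) (y m) at ha₁
  change ((p ^ M : ℕ) : ℤ) • a₂ = _ at ha₂
  rw [hPE] at ha₁ ha₂
  have hg : ∀ x, τ ((d m hm).emb x) = (d m hm).emb ((τm * h) x) := fun x ↦ by
    rw [AlgEquiv.mul_apply]; exact hres x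
  have hmap := RingClassConj.pointsMap_toGeomPoints_eq (d m hm) hτ hg (d m hm).derivedPoint
  refine ⟨(d m hm).toGeomPoints (a₂ + T a₁), ⟨a₂ + T a₁, rfl⟩, ?_⟩
  have hstep : pointGalHom W (ringClassField K ι m) (τm * h) (d m hm).derivedPoint =
      (ε * (-1) ^ m.primeFactors.card) • (d m hm).derivedPoint + ((p ^ M : ℕ) : ℤ) • (a₂ + T a₁) := by
    have h1 : pointGalHom W (ringClassField K ι m) h (d m hm).derivedPoint =
        (d m hm).derivedPoint + ((p ^ M : ℕ) : ℤ) • a₁ := by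
      rw [ha₁]; abel
    have h2 : T (d m hm).derivedPoint =
        (ε * (-1) ^ m.primeFactors.card) • (d m hm).derivedPoint + ((p ^ M : ℕ) : ℤ) • a₂ := by
      rw [ha₂]; abel
    rw [hmul, h1, ← hTapp, map_add, map_zsmul, h2, smul_add]
    abel
  rw [hmap, hstep, map_add, map_zsmul, map_zsmul]

/-- **Gross 1991 Prop. 5.4 (2) for the CONCRETE class at Zhang–Kolyvagin levels: `τ_* c_M(m) = ε_m c_M(m)`
in `H¹(K, E[p^M])`** (`conjAct W c (p^M)`, the action of the non-trivial automorphism `c` of `K`), for a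
family of data at the divisors of a square-free product `n` of Zhang–Kolyvagin primes of index `≥ M`,
modulo `h53` (Gross Prop. 5.3) and the admissibility `hA`. On the admissible/invariant branch this is
the cocycle functoriality `conjAct_kolyvaginClass_eq_smul` (Literature, *"all the maps in (4.2) commute
with Gal(K/ℚ)"*) fed with Prop. 5.4 (1) (`pointsMap_derivedPoint_concrete_of_prop53_zhang`) and the
`τ`-stability of `E(K_m) ⊆ E(K̄)` (`RingClassConj.pointsMap_mem_pointsSubgroup`); on the junk branch both
sides vanish. [cite: GrossLMS1991, §5 Prop. 5.4 (2) and proof] [cite: McCallumLMS1991, §4 (4.2), (6)] -/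
theorem conjAct_kolyvaginClass_eq_sign_smul_zhang [NeZero N] [W.IsElliptic] [W.IsGloballyMinimal]
    (hK : IsImaginaryQuadratic K) (ι : K →+* ℂ)
    {p M : ℕ} (hp : p.Prime) (hM : 1 ≤ M)
    (Dt : ModularParametrizationData W N) {β : ℤ}
    (hND : IsCoprime (N : ℤ) (NumberField.discr K)) (hD : NumberField.discr K < -4)
    {n : ℕ} (hn : Squarefree n)
    (hkol : ∀ q ∈ n.primeFactors,
      Zhang2014.IsKolyvaginPrime N W K p q ∧ M ≤ Zhang2014.kolyvaginIndex W p q)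
    (d : (m : ℕ) → m ∣ n → KolyvaginHeegnerData Dt β ι m)
    {c : K ≃ₐ[ℚ] K} (hc : c ≠ 1) (ε : ℤ)
    (h53 : ∀ (m : ℕ) (hm : m ∣ n) (τm : ringClassField K ι m ≃ₐ[ℚ] ringClassField K ι m),
      (∀ x : ringClassField K ι m, ((τm x : ringClassField K ι m) : ℂ) = starRingEnd ℂ x) →
      ∃ σ' ∈ ringClassGal ι m, IsOfFinAddOrder
        (pointGalHom W (ringClassField K ι m) τm (d m hm).y -
          ε • pointGalHom W (ringClassField K ι m) σ' (d m hm).y))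
    (hA : ∀ (m : ℕ) (hm : m ∣ n),
      IsAdmissible (absoluteGaloisGroup K) (d m hm).pointsSubgroup ((p ^ M : ℕ) : ℤ)) :
    ∀ (m : ℕ) (hm : m ∣ n),
      conjAct W c ((p ^ M : ℕ) : ℤ) ((d m hm).kolyvaginClass hp M) =
        (ε * (-1) ^ m.primeFactors.card) • (d m hm).kolyvaginClass hp M := by
  intro m hm
  have hm0 : m ≠ 0 := ne_zero_of_dvd_ne_zero hn.ne_zero hm
  by_cases h0 : (d m hm).kolyvaginClass hp M = 0
  · rw [h0, map_zero, zsmul_zero]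
  obtain ⟨hA', hP⟩ := (d m hm).kolyvaginClass_ne_zero h0
  have hτ : IsLiftOfAut c (liftAut c) := isLiftOfAut_liftAut c
  obtain ⟨B, hB, hcong⟩ :=
    pointsMap_derivedPoint_concrete_of_prop53_zhang hK ι hp hM Dt hND hD hn hkol d hc hτ ε h53 hA m hm
  rw [(d m hm).kolyvaginClass_of_admissible hp M hA' hP]
  exact conjAct_kolyvaginClass_eq_smul W hτ hA'
    (RingClassConj.pointsMap_mem_pointsSubgroup hK hm0 (d m hm) hτ) hP _ ⟨B, hB, hcong⟩

/-- **The `hκsign` input of `JET.tamagawaExponent_le_mInfty_of_rowData`, modulo Gross Prop. 5.3**, in the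
`H63` binder's currency: for `E/ℚ` globally minimal with `ρ̄_{E,p}` onto at an odd `p`, `K` imaginary
quadratic with `d_K ∉ {−3, −4}` and the Heegner hypothesis for `N = N_E`, the non-trivial `τ ∈ Aut(K/ℚ)`,
a frame `(Dt, β, ι)`, a conductor `c ∈ Λ` all of whose prime factors have index `≥ k ≥ 1`, and ANY datum
`d` of conductor `c`: `τ_* c_k(c) = e • c_k(c)` with `e = ε · (−1)^{#primes of c} ∈ {±1}` — GIVEN Gross
Prop. 5.3 at every conductor and datum for the sign `ε ∈ {±1}` (`h53`, printed *"`y_n^τ = ε y_n^{σ'} +`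
(torsion)"*, `f∣w_N = ε f`; cite-only) and the two Gross §3 CM facts making data exist at the divisors of
`c` (`phi_heegnerPointOfConductor_mem_range_map_ringClassField`, `exists_generator_ringClassGalOver`).
[cite: GrossLMS1991, §5 (5.2), Prop. 5.3, Prop. 5.4] [cite: Jetchev2008, §4.1.3 (ε(c)), proof of
Thm. 5.2 (p. 822)] -/
theorem exists_sign_conjAct_kolyvaginClass_of_prop53 [W.IsElliptic] [W.IsGloballyMinimal]
    [NeZero (W.conductorNorm ℤ)]
    (hCM1 : phi_heegnerPointOfConductor_mem_range_map_ringClassField (W.conductorNorm ℤ) W K)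
    (hCM2 : exists_generator_ringClassGalOver K)
    (hK : IsImaginaryQuadratic K) (hD3 : NumberField.discr K ≠ -3) (hD4 : NumberField.discr K ≠ -4)
    (hH : SatisfiesHeegnerHypothesis (W.conductorNorm ℤ) K)
    {p : ℕ} [Fact p.Prime] (hp2 : p ≠ 2) (hρ : W.HasSurjectiveModNGaloisRep p)
    (τ : K ≃ₐ[ℚ] K) (hτ : τ ≠ 1)
    (Dt : ModularParametrizationData W (W.conductorNorm ℤ)) (β : ℤ) (ι : K →+* ℂ)
    (ε : ℤ) (hε : ε = 1 ∨ ε = -1)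
    (h53 : ∀ (m : ℕ) (dm : KolyvaginHeegnerData Dt β ι m)
      (τm : ringClassField K ι m ≃ₐ[ℚ] ringClassField K ι m),
      (∀ x : ringClassField K ι m, ((τm x : ringClassField K ι m) : ℂ) = starRingEnd ℂ x) →
      ∃ σ' ∈ ringClassGal ι m, IsOfFinAddOrder
        (pointGalHom W (ringClassField K ι m) τm dm.y -
          ε • pointGalHom W (ringClassField K ι m) σ' dm.y))
    {c : ℕ} (hc : Squarefree c) {k : ℕ} (hk : 1 ≤ k)
    (hcK : ∀ ℓ ∈ c.primeFactors, Zhang2014.IsKolyvaginPrime (W.conductorNorm ℤ) W K p ℓ ∧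
      k ≤ Zhang2014.kolyvaginIndex W p ℓ)
    (d : KolyvaginHeegnerData Dt β ι c) :
    (ε * (-1) ^ c.primeFactors.card = 1 ∨ ε * (-1) ^ c.primeFactors.card = -1) ∧
      conjAct W τ ((p ^ k : ℕ) : ℤ) (d.kolyvaginClass (Fact.out : p.Prime) k) =
        (ε * (-1) ^ c.primeFactors.card) • d.kolyvaginClass (Fact.out : p.Prime) k := by
  have hp : p.Prime := Fact.out
  have hND : IsCoprime (W.conductorNorm ℤ : ℤ) (NumberField.discr K) :=
    KolyvaginAssembly.isCoprime_discr_of_satisfiesHeegnerHypothesis hK hH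
  have hD : NumberField.discr K < -4 := KolyvaginAssembly.discr_lt_neg_four hK ⟨hD3, hD4⟩
  have hinert : ∀ (m' : ℕ), m' ∣ c → ∀ q ∈ m'.primeFactors, (Ideal.span {(q : 𝓞 K)}).IsPrime :=
    fun m' hm' q hq ↦ (hcK q (Nat.primeFactors_mono hm' hc.ne_zero hq)).1.2.2.2.2.1
  -- data at every divisor of `c` (the given `d` at `c` itself)
  have hne : ∀ m' : ℕ, m' ∣ c → Nonempty (KolyvaginHeegnerData Dt β ι m') := fun m' hm' ↦
    BirchSwinnertonDyer.Theorems.nonempty_kolyvaginHeegnerData_of_grossCM hCM1 hCM2 hK hH Dt β ι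
      d.dvd_sq_sub (hc.squarefree_of_dvd hm') (hinert m' hm')
  let data : (m' : ℕ) → m' ∣ c → KolyvaginHeegnerData Dt β ι m' := fun m' hm' ↦
    if h : m' = c then h ▸ d else (hne m' hm').some
  have hdata : data c dvd_rfl = d := by simp [data]
  refine ⟨?_, ?_⟩
  · rcases hε with rfl | rfl <;> rcases neg_one_pow_eq_or ℤ c.primeFactors.card with h | h <;>
      simp [h]
  · have h := conjAct_kolyvaginClass_eq_sign_smul_zhang (c := τ) hK ι hp hk Dt hND hD hc hcK data hτ ε
      (fun m hm τm hτm ↦ h53 m (data m hm) τm hτm)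
      (fun m hm ↦ RingClassNoTorsion.isAdmissible_pointsSubgroup _ hK
        (ne_zero_of_dvd_ne_zero hc.ne_zero hm) hp hp2 hρ k) c dvd_rfl
    rwa [hdata] at h

end Summit.BirchSwinnertonDyer.Rank1Residual.JET

end
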